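import Literature.Geometry.Kaehler.ComplexTorusSubtorusIntersectionNumber
import Literature.Geometry.Kaehler.ComplexTorusSubtorusFundamentalCycle
import Literature.Geometry.Kaehler.ComplexTorusDualPolarizationChernClass
import HarnessLib

/-!
# Dual subtori: the class of the complementary abelian subvariety of a principally polarised torus is
# the polarisation dual of the fundamental class, `cl(B^⊥) = η♭([B])` (Bertrand 1997, §1 Prop. 1, §3 Thm. 3)

D. Bertrand, *Duality on tori and multiplicative dependence relations*, J. Austral. Math. Soc. (Series A)
**62** (1997), 198–216 [cite: Bertrand1997DualityTori], read on the tree's carriers `H_•(X, ℤ) = ⋀^• Λ`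
(Pontryagin ring, `ComplexTorusPontryaginProduct`) and `H^•(X, ℂ) = Alt^•_ℝ(E; ℂ)` (invariant forms) of a complex
torus `X = E/ΦΛ`, `Λ = ℤ^ι`, with a PRINCIPAL polarisation `η` (`IsPrincipalPolarization Φ η`).

## Source (verbatim)

* §1 (a), p. 199: "If `M` is a lattice … in an `ℝ`-vector space `W` of finite dimension, say `r`, and if `b(x, y)`
  is a non-degenerate symmetric or antisymmetric bilinear form on `W`, we denote by `Vol(M) = Vol_b M` the
  absolute value of the discriminant of `b` with respect to `M`. In terms of a basis `(m₁, …, m_r)` of `M` over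
  `ℤ`, `Vol(M)` is given by the square root of the absolute value of the determinant of the matrix
  `B(M) := (b(mᵢ, mⱼ); 1 ≤ i, j ≤ r)`."; p. 200: "`M^*` contains `M` if and only if `b` assumes integral values
  on `M` … Then, `M^*/M` is self-dual, and its order `[M^* : M] = Vol(M)/Vol(M^*) = Vol(M)²`."
* §1 (b), pp. 200–201: "PROPOSITION 1. Let `b` be a non-degenerate symmetric or antisymmetric bilinear form on a
  finite-dimensional real vector space `V`, assuming integral values on a lattice `L` in `V`. Let further `M` be
  a primitive subgroup of `L`, cut out by a regular `ℝ`-subspace `W` of `V`, and let `M^⊥` be the primitive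
  subgroup of `L` cut out by the orthogonal complement `W^⊥` of `W` in `V`. Then: (i) …
  `[L^* : M ⊕ M^⊥] = [(M^⊥)^* : M^⊥]·[W ∩ L^* : M] = [M^* : M]·[W^⊥ ∩ L^* : M^⊥]`; … (ii) …
  [When `L` is unimodular, that is, when `Vol(L) = 1`, `L^*` coincides with `L` and the whole lemma reduces to
  the classical equality: `Vol(M) = Vol(M^⊥)`.]" (for the standard scalar product this is the Brill–Gordan
  equality of complementary Plücker coordinates, §1 (c) Corollary, p. 203).
* Introduction, p. 199: "In our last section, we state and prove the 'exact formula' … for orthogonal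
  subvarieties in a polarized abelian variety. Over `ℂ`, this boils down to the study of dual subtori in
  `(ℝ/ℤ)^{2n}`"; §3, p. 211: "`H(x, y) = b(Jx, y) + ib(x, y)` is a Riemann form for the complex torus
  `A = V/L` … and the complex subtori `B = W/M`, `B^⊥ = W^⊥/M^⊥` are abelian subvarieties of `A`. …
  Thus, Proposition 1 translates into a formula (reproduced in Theorem 3 below) between the projective degrees of
  orthogonal abelian subvarieties."; §3 (a) Thm. 3, p. 212: "(i) the degree `|B ∩ B^⊥|` of the isogeny
  `σ : B × B^⊥ → A` satisfies … [When `λ` is a principal polarisation, that is, when the kernel `K(λ)` of `φ` is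
  trivial, Theorem 3 reduces to the easy equality: `deg_λ(B)/b! = deg_λ(B^⊥)/b'!`. …]"; proof of (i):
  "`(deg_λ(B)/b!)² = |B ∩ B'|`".

## Dictionary and what is proved (definitions with bodies, theorems; NO named fact)

`V = Λ ⊗ ℝ = ℝ^ι`, `L = Λ`, `b = η` the (alternating, integral, here unimodular) polarisation form transported to
`Λ ⊗ ℝ` by `Φ`; `W = V` a complex lattice subspace (`IsLatticeSubspace`, `IsComplexSubspace`), `M = Λ ∩ V =
subLattice V` with its adapted basis `u = λ ∘ eV` (`adaptedBasis`, `adaptedEmb`; `a = rk M`), `B = Y = π(ΦV)`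
(`subtorus Φ V`); `W^⊥ = V^⊥ = orthSubspace Φ η V`, `M^⊥ = Λ ∩ V^⊥` with adapted basis `w = λ' ∘ eW` (`b = rk M^⊥`,
`a + b = rk Λ`), `B^⊥ = Z = π(ΦV^⊥)`; `M^*/M = K(ι_Y^*Θ) = subK Φ η V`; `[Y] = u₀ ⋆ ⋯ ⋆ u_{a-1} ∈ H_a(X, ℤ) = ⋀^a Λ`
(`exteriorPower.ιMulti`, tree `subtorusFundamentalCycle`); `cl(Z) = [Z_w] = (Φw) ⌟ vol ∈ Hᵃ(X, ℤ)` (tree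
`cycleFormOfFrame`, `SubtorusFrame.cycleForm`, Poincaré dual `cyclePoincareDual`).

* §1 `polCovectorInt Φ η : Λ → H¹(X, ℝ)`, `m ↦ η(Φm, ·)` (the tree's covector `twoFormLeft η (Φm)`); the
  polarisation map **`η♭ = polFlat Φ η k : H_k(X, ℤ) = ⋀^k Λ → Hᵏ(X, ℂ)`**,
  `η♭(m₀ ⋆ ⋯ ⋆ m_{k-1}) = η(Φm₀, ·) ∧ ⋯ ∧ η(Φm_{k-1}, ·)` (universal property of `⋀^k`, as Q86's `dualityD`),
  with `η♭(m₀ ⋆ ⋯ ⋆ m_{k-1})(v) = det (η(Φmᵢ, vⱼ))` (`polFlat_ιMulti_apply`, tree `wedgeSeq_one_apply`) —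
  Bertrand's `x ↦ b(x, ·)` on `k`-vectors, whose Gram determinants are the `Vol²`.
* §2 **`det B(M) = [M^* : M]`**: `IsRiemannForm.det_gram_adaptedBasis_eq_natCard_subK`,
  `det (η(Φuᵢ, Φuⱼ)) = #K(ι_Y^*L)` for every polarisation (symplectic basis of `M`, tree `IsSubPolarizationType`,
  `IsSubPolarizationType.natCard_subK`); **Brill–Gordan / Prop. 1 for unimodular `L`: `Vol(M)² = Vol(M^⊥)²`**,
  `IsPrincipalPolarization.det_gram_adaptedBasis_eq_det_gram_orthSubspace` (`K(ι_Y^*Θ) ≃ K(ι_Z^*Θ)`).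
* §3 **THE DUALITY THEOREM** `IsPrincipalPolarization.cycleFormOfFrame_orthSubspace_eq_smul_polFlat`:
  `cl(Z) = [Z_w] = sign_Z(eW) · sign_Y(eV) · η♭([Y])` — both sides are alternating `a`-forms, compared on the
  sub-families of the real basis `Φw ⊔ Φu` of `E`: a family through some `Φwⱼ` kills both (`M ⟂ M^⊥`), and on
  `Φu`: `[Z_w](Φu) = vol(Φw ⊔ Φu) = ± #(Z ∩ Y)` (Bézout for complementary complex subtori, tree
  `torusIntegral_cycleForm_wedge_cycleForm_eq_sign_mul_natCard`) `= ± [M^* : M]` (Lange's Cor. 5.3.4, tree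
  `IsPrincipalPolarization.subKEquivInter`) `= ± det B(M) = ± η♭([Y])(Φu)` (§2) — Bertrand's
  "`(deg_λ(B)/b!)² = |B ∩ B'|`" and "`[M^* : M] = Vol(M)²`" assembled on forms.
* §4 consequences: `η♭(H_a(X, ℤ)) ⊆ Hᵃ(X, ℤ)` (`polFlat_mem_integralForms`); the theorem for a pair
  `(V, W = V^⊥)` and the symmetric statement `cl(Y) = ± η♭([Z])` (`(V^⊥)^⊥ = V`); `η♭([Y]) = ± cl(Z)`;
  **`cl(Z) = η♭([Y])` on the nose for complex orientations** (`cycleFormOfFrame_orthSubspace_eq_polFlat`,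
  `cycleForm_ofSubspace_orthSubspace_eq_polFlat`) and **for arbitrary subtorus data presenting `Y`, `Z`**
  (`cycleForm_eq_polFlat_of_realSpan_eq`, through the new `SubtorusFrame.ιMulti_frame_eq_of_realSpan_eq`: the
  fundamental class of a subtorus datum depends only on the subtorus); the Poincaré-dual forms
  `P([Z]) = ± η♭([Y])` (`cyclePoincareDual_orthSubspace_eq_smul_polFlat`,
  `cyclePoincareDual_subtorusFundamentalCycle_orthSubspace`); `∫_X θ ∧ η♭([Y]) = ± ∫_Z θ`
  (`torusIntegral_wedge_polFlat`, `torusIntegral_wedge_polFlat_eq_cycleIntegral`).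

Bertrand's general (non-principal) Prop. 1 / Thm. 3, with the correcting indices `[W ∩ L^* : M]`, and the
multidegree Corollary of §3 (b) are not treated here. TODO(general form): Prop. 1 (i)–(ii) on forms for a
non-unimodular `L` (the counts are the tree's `natCard_subK_mul_natCard_subK`, `natCard_kerPhiH_eq_mul` of
`ComplexTorusComplementaryRestrictedPolarizations`).

## References

* [cite: Bertrand1997DualityTori] D. Bertrand, Duality on tori and multiplicative dependence relations,
  J. Austral. Math. Soc. Ser. A 62 (1997), 198–216, §1 Prop. 1 and Corollary, §3 Thm. 3.
* [cite: Lange2023AbelianVarietiesComplex] H. Lange, Abelian Varieties over the Complex Numbers (2023),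
  §5.3.1 Cor. 5.3.4–5.3.5 (complementary abelian subvarieties, `K(ι_Y^*Θ) ≃ Y ∩ Z`), §2.5.3 Lemma 2.5.14
  (Poincaré duality `P`), §4.2 (fundamental classes), §1.1.6 Exercise (2)(a).
* [cite: Arapura2012] D. Arapura, Algebraic Geometry over the Complex Numbers, §5.6 Prop. 5.6.3 (Bézout on tori).
-/

noncomputable section

open scoped Matrix
open Module Function Complex Submodule
open Literature.LinearAlgebra.Alternating

namespace Literature.Geometry.Kaehler

namespace ComplexTorus

/-! ## §1 The polarisation map `η♭ : H_k(X, ℤ) → Hᵏ(X, ℂ)`, `m₀ ⋆ ⋯ ⋆ m_{k-1} ↦ η(Φm₀, ·) ∧ ⋯ ∧ η(Φm_{k-1}, ·)` -/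

section Flat

variable {ι : Type*} {E : Type*} [NormedAddCommGroup E] [NormedSpace ℂ E]
  (Φ : (ι → ℝ) ≃L[ℝ] E) (η : E [⋀^Fin 2]→L[ℝ] ℝ) {k : ℕ}

/-- `Φ(m + n) = Φm + Φn` for lattice vectors. [folklore] -/
private theorem latticeVec_add' (m n : ι → ℤ) : latticeVec Φ (m + n) = latticeVec Φ m + latticeVec Φ n := by
  change Φ (fun i ↦ ((m + n) i : ℝ)) = Φ (fun i ↦ (m i : ℝ)) + Φ (fun i ↦ (n i : ℝ))
  rw [← map_add]
  congr 1
  funext i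
  simp

/-- `Φ(c • m) = c • Φm` for lattice vectors. [folklore] -/
private theorem latticeVec_zsmul' (c : ℤ) (m : ι → ℤ) : latticeVec Φ (c • m) = (c : ℝ) • latticeVec Φ m := by
  change Φ (fun i ↦ ((c • m) i : ℝ)) = (c : ℝ) • Φ (fun i ↦ (m i : ℝ))
  rw [← map_smul]
  congr 1
  funext i
  simp

/-- **`η♭` in degree one, `Λ = H₁(X, ℤ) → H¹(X, ℝ)`, `m ↦ η(Φm, ·)`** (the tree's covector `twoFormLeft η (Φm)`),
`ℤ`-linear in `m`: Bertrand's `x ↦ b(x, ·)`, whose values on `M` cut out the dual lattice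
`M^* = {x ∈ W, b(x, m) ∈ ℤ for all m ∈ M}`, and the lattice map of the isogeny `φ` of the polarisation.
[cite: Bertrand1997DualityTori, §1 (a) (p. 199) and §3 (a) (p. 211)] -/
def polCovectorInt : (ι → ℤ) →ₗ[ℤ] (E →L[ℝ] ℝ) where
  toFun m := twoFormLeft η (latticeVec Φ m)
  map_add' m n := by
    ext v
    change η ![latticeVec Φ (m + n), v] = η ![latticeVec Φ m, v] + η ![latticeVec Φ n, v]
    rw [latticeVec_add']
    exact η.vecCons_add ![v] _ _
  map_smul' c m := by
    ext v
    change η ![latticeVec Φ (c • m), v] = c • η ![latticeVec Φ m, v]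
    rw [latticeVec_zsmul', η.vecCons_smul ![v], zsmul_eq_mul, smul_eq_mul]

/-- Unfolding: `polCovectorInt Φ η m = η(Φm, ·)`. [cite: Bertrand1997DualityTori, §1 (a) (p. 199)] -/
@[simp] theorem polCovectorInt_apply (m : ι → ℤ) (v : E) : polCovectorInt Φ η m v = η ![latticeVec Φ m, v] := rfl

/-- `polCovectorInt Φ η m` is the tree's `twoFormLeft η (Φm)`. [cite: Bertrand1997DualityTori, §1 (a) (p. 199)] -/
theorem polCovectorInt_eq_twoFormLeft (m : ι → ℤ) : polCovectorInt Φ η m = twoFormLeft η (latticeVec Φ m) := rfl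

/-- **`η♭` on tuples of lattice vectors: `(m₀, …, m_{k-1}) ↦ η(Φm₀, ·) ∧ ⋯ ∧ η(Φm_{k-1}, ·)`** (complex-valued:
the wedge of the real covectors into the constant `0`-form `1 ∈ H⁰(X, ℂ)`), multilinear and alternating in the
`mⱼ` (tree `wedgeSeqMultilinear`, `wedgeSeq_eq_zero_of_eq`) — the construction of Q86's `dualityDAlt` with the
coordinate covectors `dx_m` replaced by the polarisation covectors `η(Φm, ·)`.
[cite: Bertrand1997DualityTori, §1 (a)–(b) (pp. 199–200: the map `x ↦ b(x, ·)`, the dual lattices `M^*`, `L^*`) and §3 (a) (p. 211)] -/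
def polFlatAlt (k : ℕ) : (ι → ℤ) [⋀^Fin k]→ₗ[ℤ] (E [⋀^Fin k]→L[ℝ] ℂ) :=
  { ((wedgeSeqMultilinear (𝕜 := ℝ) (ContinuousAlternatingMap.constOfIsEmpty ℝ E (Fin 0) (1 : ℂ)) k).restrictScalars
        ℤ).compLinearMap (fun _ ↦ polCovectorInt Φ η) with
    map_eq_zero_of_eq' := fun m i j hij hne ↦ by
      change wedgeSeq (ContinuousAlternatingMap.constOfIsEmpty ℝ E (Fin 0) (1 : ℂ)) k
        (fun l ↦ polCovectorInt Φ η (m l)) = 0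
      exact wedgeSeq_eq_zero_of_eq _ _ hne (by simp only [hij]) }

/-- Unfolding of `polFlatAlt`: the value on a tuple is the wedge of the covectors `η(Φmⱼ, ·)`.
[cite: Bertrand1997DualityTori, §1 (a)–(b) (pp. 199–200)] -/
theorem polFlatAlt_apply (m : Fin k → (ι → ℤ)) :
    polFlatAlt Φ η k m = wedgeSeq (ContinuousAlternatingMap.constOfIsEmpty ℝ E (Fin 0) (1 : ℂ)) k
      (fun j ↦ twoFormLeft η (latticeVec Φ (m j))) :=
  rfl

/-- **The polarisation map `η♭ : H_k(X, ℤ) → Hᵏ(X, ℂ)`, `η♭(m₀ ⋆ ⋯ ⋆ m_{k-1}) = η(Φm₀, ·) ∧ ⋯ ∧ η(Φm_{k-1}, ·)`**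
— the `ℤ`-linear extension to `H_k(X, ℤ) = ⋀^k Λ` (universal property) of `polFlatAlt`: the map induced on
`k`-cycles by `λ ↦ η(λ, ·)`, `Λ → Λ^* = H¹(X, ℤ)` (for an integral `η` it is the lattice map of
`φ_λ : A → A^∨`, Bertrand §3 (a); in §1 it is `x ↦ b(x, ·)`, whose restriction to a primitive sublattice `M`
computes `M^*` and `Vol(M)`). [cite: Bertrand1997DualityTori, §1 (a)–(b) (pp. 199–201) and §3 (a) (pp. 211–212)] -/
def polFlat (k : ℕ) :=
  exteriorPower.alternatingMapLinearEquiv (R := ℤ) (N := E [⋀^Fin k]→L[ℝ] ℂ) (polFlatAlt Φ η k)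

/-- `η♭(m₀ ⋆ ⋯ ⋆ m_{k-1})` is the wedge of the covectors `η(Φmⱼ, ·)`.
[cite: Bertrand1997DualityTori, §1 (a)–(b) (pp. 199–200)] -/
theorem polFlat_ιMulti (m : Fin k → (ι → ℤ)) :
    polFlat Φ η k (exteriorPower.ιMulti ℤ k m) = wedgeSeq (ContinuousAlternatingMap.constOfIsEmpty ℝ E (Fin 0) (1 : ℂ)) k
      (fun j ↦ twoFormLeft η (latticeVec Φ (m j))) := by
  rw [polFlat, exteriorPower.alternatingMapLinearEquiv_apply_ιMulti, polFlatAlt_apply]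

/-- **The Gram–determinant formula `η♭(m₀ ⋆ ⋯ ⋆ m_{k-1})(v₀, …, v_{k-1}) = det (η(Φmᵢ, vⱼ))`** (the wedge
of `1`-forms evaluates as the determinant of the pairing matrix, Warner 2.6 / tree `wedgeSeq_one_apply`).
[cite: Bertrand1997DualityTori, §1 (a) ("`Vol(M)` is … the square root of … the determinant of the matrix `B(M) := (b(mᵢ, mⱼ))`", p. 199)] -/
theorem polFlat_ιMulti_apply (m : Fin k → (ι → ℤ)) (v : Fin k → E) :
    polFlat Φ η k (exteriorPower.ιMulti ℤ k m) v =
      ((Matrix.of fun i j ↦ η ![latticeVec Φ (m i), v j]).det : ℂ) := by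
  rw [polFlat_ιMulti, wedgeSeq_one_apply]
  rfl

/-- On a single `1`-cycle: `η♭(m)(v) = η(Φm, v)`. [cite: Bertrand1997DualityTori, §3 (a) (p. 211: the isogeny `φ` of `λ`)] -/
theorem polFlat_ιMulti_one_apply (m : Fin 1 → (ι → ℤ)) (v : Fin 1 → E) :
    polFlat Φ η 1 (exteriorPower.ιMulti ℤ 1 m) v = (η ![latticeVec Φ (m 0), v 0] : ℂ) := by
  rw [polFlat_ιMulti_apply, Matrix.det_fin_one, Matrix.of_apply]

/-- **A zero column kills `η♭`**: if some `vⱼ` is `η`-orthogonal to all the `Φmᵢ` then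
`η♭(m₀ ⋆ ⋯ ⋆ m_{k-1})(v) = 0`. [cite: Bertrand1997DualityTori, §1 (b) Prop. 1 (proof, p. 201: "Since `b(x, y) = b(p(x), y)` for all `(x, y)` in `V × W^⊥`", `p` the orthogonal projection from `V` to `W^⊥`)] -/
theorem polFlat_ιMulti_apply_eq_zero_of_column (m : Fin k → (ι → ℤ)) (v : Fin k → E) (j : Fin k)
    (h : ∀ i, η ![latticeVec Φ (m i), v j] = 0) : polFlat Φ η k (exteriorPower.ιMulti ℤ k m) v = 0 := by
  rw [polFlat_ιMulti_apply, Matrix.det_eq_zero_of_column_eq_zero j fun i ↦ by rw [Matrix.of_apply, h i],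
    Complex.ofReal_zero]

end Flat

/-! ## §2 `det (η(λᵢ, λⱼ))_{Λ ∩ V} = #K(ι_Y^*L)` — the Gram determinant of the polarisation on the lattice of a sub-torus -/

section Gram

variable {ι : Type*} [Fintype ι] {E : Type*} [NormedAddCommGroup E] [NormedSpace ℂ E]
  (Φ : (ι → ℝ) ≃L[ℝ] E) {η : E [⋀^Fin 2]→L[ℝ] ℝ} {V : Submodule ℝ (ι → ℝ)}

/-- **`det B(M) = Vol(M)² = #K(ι_Y^*L)`.** For a polarised torus `(X = E/ΦΛ, η)` and a complex sub-torus
`Y = π(V)` with lattice `M = Λ_Y = Λ ∩ V` and adapted `ℤ`-basis `λ₁, …, λ_{2r}` of `M`, the Gram determinant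
of the polarisation on `M` is the order of `K(ι_Y^*L)`:
`det (η(Φλᵢ, Φλⱼ))ᵢⱼ = (d₁⋯d_r)² = #K(ι_Y^*L)`, `(d₁, …, d_r)` the type of `ι_Y^*L` (Bertrand: "`Vol(M)` is the
`b`-dimensional volume of `W/M` … the square root of the absolute value of the determinant of the matrix
`B(M) := (b(mᵢ, mⱼ))`"; here `b = η` is alternating and `det B(M) = Pf² > 0`). Proof: the change of basis from
the adapted basis to a symplectic basis of `M` (tree `IsSubPolarizationType`) is unimodular and
`ᵗP · B(M) · P = (0 D; -D 0)`, `det = (det D)²`; and `#K(ι_Y^*L) = (d₁⋯d_r)²` (tree `IsSubPolarizationType.natCard_subK`).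
[cite: Bertrand1997DualityTori, §1 (a) (p. 200: "`M^*` contains `M` if and only if `b` assumes integral values on `M` … Then, `M^*/M` is self-dual, and its order `[M^* : M] = Vol(M)/Vol(M^*) = Vol(M)²`") with §3 (p. 211: "the complex subtori `B = W/M`, `B^⊥ = W^⊥/M^⊥` are abelian subvarieties of `A`")] -/
theorem IsRiemannForm.det_gram_adaptedBasis_eq_natCard_subK (hη : IsRiemannForm Φ η) (hV : IsLatticeSubspace V)
    (hVc : IsComplexSubspace Φ V) {a : ℕ} (eV : Fin a ≃ Fin (subRank V)) :
    (Matrix.of fun i j ↦ η ![latticeVec Φ (adaptedBasis V (adaptedEmb V (eV i))),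
        latticeVec Φ (adaptedBasis V (adaptedEmb V (eV j)))]).det = (Nat.card (subK Φ η V) : ℝ) := by
  classical
  obtain ⟨g, d, hd, -⟩ := hη.exists_isSubPolarizationType Φ hV hVc
  rw [hd.natCard_subK Φ hη hV hVc]
  obtain ⟨-, b, huu, hvv, huv⟩ := hd
  obtain ⟨B, hB⟩ := exists_subLatticeForm Φ hη V
  -- the adapted basis of `Λ ∩ V`, re-indexed by `Fin a`
  let b₂ : Basis (Fin a) ℤ (subLattice V) := (subLatticeBasis V).reindex eV.symm
  have hb₂ : ∀ i, (b₂ i : ι → ℤ) = adaptedBasis V (adaptedEmb V (eV i)) := fun i ↦ by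
    simp only [b₂, Basis.reindex_apply, Equiv.symm_symm, subLatticeBasis_apply]
  -- the symplectic basis, re-indexed by `Fin a`, and the unimodular change of basis
  let e : Fin g ⊕ Fin g ≃ Fin a := b.indexEquiv b₂
  let b' : Basis (Fin a) ℤ (subLattice V) := b.reindex e
  let P : Matrix (Fin a) (Fin a) ℤ := b₂.toMatrix b'
  have hP : P.det * P.det = 1 := by
    have : Invertible P := b₂.invertibleToMatrix b'
    exact Int.isUnit_mul_self (Matrix.isUnit_det_of_invertible P)
  have hdet : (LinearMap.BilinForm.toMatrix b₂ B).det = (LinearMap.BilinForm.toMatrix b' B).det := by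
    have h := congrArg Matrix.det (LinearMap.BilinForm.toMatrix_mul_basis_toMatrix b₂ b' B)
    rw [Matrix.det_mul, Matrix.det_mul, Matrix.det_transpose] at h
    calc (LinearMap.BilinForm.toMatrix b₂ B).det = (LinearMap.BilinForm.toMatrix b₂ B).det * (P.det * P.det) := by rw [hP, mul_one]
      _ = P.det * (LinearMap.BilinForm.toMatrix b₂ B).det * P.det := by ring
      _ = (LinearMap.BilinForm.toMatrix b' B).det := h
  -- the symplectic normal form over `ℝ`
  let F : Matrix (Fin g ⊕ Fin g) (Fin g ⊕ Fin g) ℝ :=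
    Matrix.fromBlocks 0 (Matrix.diagonal fun i ↦ (d i : ℝ)) (-Matrix.diagonal fun i ↦ (d i : ℝ)) 0
  have hF : ∀ s t, η ![Φ (intVec (b s : ι → ℤ)), Φ (intVec (b t : ι → ℤ))] = F s t := by
    rintro (s | s) (t | t)
    · simp [F, huu]
    · simp [F, huv, Matrix.diagonal_apply]
    · rw [twoForm_swap, huv]
      by_cases h : t = s
      · subst h; simp [F]
      · simp [F, h, Ne.symm h]
    · simp [F, hvv]
  have h1 : (LinearMap.BilinForm.toMatrix b' B).map (fun x : ℤ ↦ (x : ℝ)) = Matrix.reindex e e F := by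
    ext i j
    rw [Matrix.map_apply, LinearMap.BilinForm.toMatrix_apply, hB, Matrix.reindex_apply, Matrix.submatrix_apply, ← hF]
    simp only [b', Basis.reindex_apply]
  have h2 : (LinearMap.BilinForm.toMatrix b₂ B).map (fun x : ℤ ↦ (x : ℝ)) =
      Matrix.of fun i j ↦ η ![latticeVec Φ (adaptedBasis V (adaptedEmb V (eV i))),
        latticeVec Φ (adaptedBasis V (adaptedEmb V (eV j)))] := by
    ext i j
    rw [Matrix.map_apply, LinearMap.BilinForm.toMatrix_apply, hB, Matrix.of_apply, hb₂, hb₂]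
    rfl
  rw [← h2, ← Int.cast_det, hdet, Int.cast_det, h1, Matrix.det_reindex_self, Matrix.det_fromBlocks_zero_neg_zero,
    Matrix.det_diagonal]
  push_cast
  ring

/-- **Brill–Gordan duality `Vol(M) = Vol(M^⊥)`** for the lattices of a complex sub-torus and of its
complement in a principally polarised torus: the Gram determinants of `η` on adapted bases of `M = Λ ∩ V` and
of `M^⊥ = Λ ∩ V^⊥` agree, `det (η(λᵢ, λⱼ))_{M} = det (η(λ'ₖ, λ'ₗ))_{M^⊥}` — both are `#K(ι_Y^*Θ) = #(Y ∩ Z) =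
#K(ι_Z^*Θ)` (tree `IsPrincipalPolarization.subKEquivSubKOrth`). ("PROPOSITION 1. Let `M` be a primitive
subgroup of `L`. Then, `M^⊥ := {λ ∈ L, b(λ, m) = 0 for all m ∈ M}` is a primitive subgroup of `L` of rank
`b' = n - b`, and satisfies: `Vol(M) = Vol(M^⊥)`." — here for the unimodular alternating lattice
`(Λ, η)` of a principal polarisation and the sublattice of a complex sub-torus.)
[cite: Bertrand1997DualityTori, §1 (b) Prop. 1 (pp. 200–201: "[When `L` is unimodular, that is, when `Vol(L) = 1`, `L^*` coincides with `L` and the whole lemma reduces to the classical equality: `Vol(M) = Vol(M^⊥)`.]") and §3 (a) Thm. 3 (i) (p. 212)] -/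
theorem IsPrincipalPolarization.det_gram_adaptedBasis_eq_det_gram_orthSubspace [DecidableEq ι] (hp : IsPrincipalPolarization Φ η)
    (hV : IsLatticeSubspace V) (hVc : IsComplexSubspace Φ V) {a b : ℕ} (eV : Fin a ≃ Fin (subRank V))
    (eW : Fin b ≃ Fin (subRank (orthSubspace Φ η V))) :
    (Matrix.of fun i j ↦ η ![latticeVec Φ (adaptedBasis V (adaptedEmb V (eV i))),
        latticeVec Φ (adaptedBasis V (adaptedEmb V (eV j)))]).det =
      (Matrix.of fun k l ↦ η ![latticeVec Φ (adaptedBasis (orthSubspace Φ η V) (adaptedEmb _ (eW k))),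
        latticeVec Φ (adaptedBasis (orthSubspace Φ η V) (adaptedEmb _ (eW l)))]).det := by
  rw [hp.isRiemannForm.det_gram_adaptedBasis_eq_natCard_subK Φ hV hVc eV,
    hp.isRiemannForm.det_gram_adaptedBasis_eq_natCard_subK Φ
      (isLatticeSubspace_orthSubspace Φ hp.isRiemannForm hV hVc) (isComplexSubspace_orthSubspace Φ hp.isRiemannForm.1 hVc) eW,
    Nat.card_congr (hp.subKEquivSubKOrth Φ hV hVc).toEquiv]

end Gram

/-! ## §3 The duality theorem `cl(Z) = ± η♭([Y])` for the complementary pair `(Y, Z = Y^⊥)` of a principally polarised torus -/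

section Duality

variable {ι : Type*} [Fintype ι] [DecidableEq ι] {E : Type*} [NormedAddCommGroup E] [NormedSpace ℂ E]
  (Φ : (ι → ℝ) ≃L[ℝ] E) {η : E [⋀^Fin 2]→L[ℝ] ℝ} {V : Submodule ℝ (ι → ℝ)} {a b : ℕ}

/-- **THE DUALITY THEOREM `cl(B^⊥) = ± η♭([B])` ("over `ℂ` this boils down to the study of dual subtori").**
Let `(X = E/ΦΛ, η)` be a PRINCIPALLY polarised torus, `Y = π(ΦV)` a complex sub-torus (lattice `M = Λ ∩ V` of
rank `a`, adapted basis `u = λ ∘ eV`) and `Z = Y^⊥ = π(ΦV^⊥)` its complementary sub-torus (lattice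
`M^⊥ = Λ ∩ V^⊥` of rank `b`, adapted basis `w = λ' ∘ eW`, `a + b = rk Λ`). Then the Poincaré-dual class of `Z`,
the invariant `a`-form `cl(Z) = [Z_w] = (Φw) ⌟ vol ∈ Hᵃ(X, ℤ)`, IS the image of the fundamental class
`[Y] = u₀ ⋆ ⋯ ⋆ u_{a-1} ∈ H_a(X, ℤ) = ⋀^a Λ` under the polarisation map `η♭`:
`cl(Z) = sign_Z(eW) · sign_Y(eV) · η♭([Y])`, i.e. `[Z_w](v) = ± det (η(Φuᵢ, vⱼ))` for all `v` — the two signs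
being the orientation characters of the chosen enumerations (both `+1` for complex orientations,
`cycleFormOfFrame_orthSubspace_eq_polFlat`). Proof (Bertrand's Prop. 1 / Thm. 3 read on forms): both sides are
alternating, so it suffices to compare them on sub-families of the real basis `Φw ⊔ Φu` of `E`
(`V ⊕ V^⊥ = Λ ⊗ ℝ`); a family containing some `Φwⱼ` kills both (`vol` has a repeated entry; the column
`η(Φuᵢ, Φwⱼ) = 0` as `M ⟂ M^⊥`), and on `Φu` itself `[Z_w](Φu) = vol(Φw ⊔ Φu) = ± #(Z ∩ Y)` (Bézout for
complementary complex subtori, tree `torusIntegral_cycleForm_wedge_cycleForm_eq_sign_mul_natCard`) while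
`η♭([Y])(Φu) = det (η(Φuᵢ, Φuⱼ)) = #K(ι_Y^*Θ) = #(Y ∩ Z)` (§2 and Lange's Cor. 5.3.4, tree
`IsPrincipalPolarization.subKEquivInter`) — "`deg_λ(B)/b! = Vol(M) = Vol(M^⊥) = deg_λ(B^⊥)/b'!`".
[cite: Bertrand1997DualityTori, §1 (b) Prop. 1 (pp. 200–201: "`Vol(M) = Vol(M^⊥)`"; proof, p. 201: "`[L^* : M ⊕ M^⊥] = [(M^⊥)^* : M^⊥]·[W ∩ L^* : M]`", "`(M^⊥)^⊥ := L ∩ (W^⊥)^⊥ = L ∩ W = M`") and §3 Thm. 3 (p. 199: "Over `ℂ`, this boils down to the study of dual subtori in `(ℝ/ℤ)^{2n}`"; p. 212: "When `λ` is a principal polarisation … Theorem 3 reduces to the easy equality: `deg_λ(B)/b! = deg_λ(B^⊥)/b'!`", proof of (i): "`(deg_λ(B)/b!)² = |B ∩ B'|`")] -/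
theorem IsPrincipalPolarization.cycleFormOfFrame_orthSubspace_eq_smul_polFlat (hp : IsPrincipalPolarization Φ η)
    (hV : IsLatticeSubspace V) (hVc : IsComplexSubspace Φ V) (hW : IsLatticeSubspace (orthSubspace Φ η V))
    (hWc : IsComplexSubspace Φ (orthSubspace Φ η V)) (e : Fin (b + a) ≃ ι) (eV : Fin a ≃ Fin (subRank V))
    (eW : Fin b ≃ Fin (subRank (orthSubspace Φ η V))) :
    cycleFormOfFrame Φ e (fun j ↦ adaptedBasis (orthSubspace Φ η V) (adaptedEmb _ (eW j))) =
      ((orientationSign (subtorusPeriod Φ (orthSubspace Φ η V) hW hWc) eW *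
          orientationSign (subtorusPeriod Φ V hV hVc) eV : ℤ) : ℂ) •
        polFlat Φ η a (exteriorPower.ιMulti ℤ a fun i ↦ adaptedBasis V (adaptedEmb V (eV i))) := by
  have hη := hp.isRiemannForm
  set u : Fin a → (ι → ℤ) := fun i ↦ adaptedBasis V (adaptedEmb V (eV i)) with hudef
  set w : Fin b → (ι → ℤ) := fun j ↦ adaptedBasis (orthSubspace Φ η V) (adaptedEmb _ (eW j)) with hwdef
  have hu : ∀ i, intVec (u i) ∈ V := fun i ↦ (mem_subLattice_iff).1 (adaptedBasis_adaptedEmb_mem V (eV i))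
  have hw : ∀ j, intVec (w j) ∈ orthSubspace Φ η V := fun j ↦
    (mem_subLattice_iff).1 (adaptedBasis_adaptedEmb_mem (orthSubspace Φ η V) (eW j))
  -- permutations act on continuous alternating maps through the sign
  have hperm : ∀ (f : E [⋀^Fin a]→L[ℝ] ℂ) (x : Fin a → E) (σ : Equiv.Perm (Fin a)),
      f (x ∘ σ) = Equiv.Perm.sign σ • f x := fun f x σ ↦ f.toAlternatingMap.map_perm x σ
  -- the other enumeration of `ι`, `a` first
  let e' : Fin (a + b) ≃ ι := (finCongr (Nat.add_comm a b)).trans e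
  -- (1) `vol(Φw ⊔ Φu) = sign_Z · sign_Y · #(Z ∩ Y)` (Bézout for the complementary complex subtori `Z`, `Y`)
  have hvol : volumeForm Φ e (latticeTuple Φ (Fin.append w u)) =
      ((orientationSign (subtorusPeriod Φ (orthSubspace Φ η V) hW hWc) eW * orientationSign (subtorusPeriod Φ V hV hVc) eV *
        (Nat.card ↥(subtorus Φ (orthSubspace Φ η V) ⊓ subtorus Φ V) : ℤ) : ℤ) : ℂ) := by
    rw [← torusIntegral_cycleFormOfFrame_wedge_cycleFormOfFrame Φ e e' w u]
    exact torusIntegral_cycleForm_wedge_cycleForm_eq_sign_mul_natCard Φ hW hWc hV hVc e e' eW eV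
  -- (2) `#(Z ∩ Y) = #K(ι_Y^*Θ) ≥ 1`
  have hcard : Nat.card ↥(subtorus Φ (orthSubspace Φ η V) ⊓ subtorus Φ V) = Nat.card (subK Φ η V) := by
    rw [inf_comm]
    exact (Nat.card_congr (hp.subKEquivInter Φ hV hVc).toEquiv).symm
  have hpos : 1 ≤ Nat.card ↥(subtorus Φ (orthSubspace Φ η V) ⊓ subtorus Φ V) :=
    one_le_natCard_inf_subtorus Φ hW hWc hV hVc (isCompl_orthSubspace Φ hη hVc).symm
  -- (3) hence `Φw ⊔ Φu` is a real basis of `E`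
  have hne : (latticeBasis Φ e).det (latticeTuple Φ (Fin.append w u)) ≠ 0 := by
    intro h0
    have h1 := hvol
    rw [volumeForm_apply, h0, mul_zero, Complex.ofReal_zero] at h1
    have h2 : (orientationSign (subtorusPeriod Φ (orthSubspace Φ η V) hW hWc) eW *
        orientationSign (subtorusPeriod Φ V hV hVc) eV *
        (Nat.card ↥(subtorus Φ (orthSubspace Φ η V) ⊓ subtorus Φ V) : ℤ) : ℤ) = 0 := by exact_mod_cast h1.symm
    rcases orientationSign_eq_or (subtorusPeriod Φ (orthSubspace Φ η V) hW hWc) eW with hs | hs <;>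
      rcases orientationSign_eq_or (subtorusPeriod Φ V hV hVc) eV with hs' | hs' <;>
      · rw [hs, hs'] at h2; omega
  obtain ⟨hli, hsp⟩ := (latticeBasis Φ e).is_basis_iff_det.2 (isUnit_iff_ne_zero.2 hne)
  let β : Basis (Fin (b + a)) ℝ E := Basis.mk hli hsp.ge
  let β' : Basis (Fin b ⊕ Fin a) ℝ E := β.reindex finSumFinEquiv.symm
  have hβl : ∀ j, β' (Sum.inl j) = latticeVec Φ (w j) := fun j ↦ by
    simp only [β', β, Basis.reindex_apply, Equiv.symm_symm, finSumFinEquiv_apply_left, Basis.mk_apply,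
      latticeTuple_apply, Fin.append_left]
  have hβr : ∀ i, β' (Sum.inr i) = latticeVec Φ (u i) := fun i ↦ by
    simp only [β', β, Basis.reindex_apply, Equiv.symm_symm, finSumFinEquiv_apply_right, Basis.mk_apply,
      latticeTuple_apply, Fin.append_right]
  -- (4) the key value: both sides agree on `Φu`
  have hdet : (Matrix.of fun i j ↦ η ![latticeVec Φ (u i), latticeTuple Φ u j]).det = (Nat.card (subK Φ η V) : ℝ) := by
    simp only [latticeTuple_apply, hudef]
    exact hη.det_gram_adaptedBasis_eq_natCard_subK Φ hV hVc eV
  have key : cycleFormOfFrame Φ e w (latticeTuple Φ u) =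
      ((((orientationSign (subtorusPeriod Φ (orthSubspace Φ η V) hW hWc) eW *
          orientationSign (subtorusPeriod Φ V hV hVc) eV : ℤ) : ℂ)) • polFlat Φ η a (exteriorPower.ιMulti ℤ a u))
        (latticeTuple Φ u) := by
    rw [ContinuousAlternatingMap.smul_apply, cycleFormOfFrame_apply, append_latticeTuple, hvol, polFlat_ιMulti_apply,
      hdet, hcard, smul_eq_mul]
    push_cast
    ring
  -- (5) compare on all sub-families of the basis `β'`
  refine ContinuousAlternatingMap.toAlternatingMap_injective (β'.ext_alternating fun v hv ↦ ?_)
  simp only [ContinuousAlternatingMap.coe_toAlternatingMap]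
  by_cases hall : ∀ i, ∃ k, v i = Sum.inr k
  · -- all entries from `Φu`: a permutation of `Φu`
    choose τ hτ using hall
    have hτ' : Function.Injective τ := fun i j h ↦ hv (by rw [hτ i, hτ j, h])
    let σ : Equiv.Perm (Fin a) := Equiv.ofBijective τ (Finite.injective_iff_bijective.1 hτ')
    have hvσ : (fun i ↦ β' (v i)) = latticeTuple Φ u ∘ σ := funext fun i ↦ by
      rw [hτ i, hβr, Function.comp_apply, latticeTuple_apply]
      rfl
    rw [hvσ, hperm, hperm, key]
  · -- some entry `Φwⱼ`: both sides vanish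
    push Not at hall
    obtain ⟨i, hi⟩ := hall
    obtain ⟨j, hj⟩ : ∃ j, v i = Sum.inl j := by
      cases h : v i with
      | inl j => exact ⟨j, rfl⟩
      | inr k => exact absurd h (hi k)
    have hL : cycleFormOfFrame Φ e w (fun i ↦ β' (v i)) = 0 := by
      rw [cycleFormOfFrame_apply]
      refine (volumeForm Φ e).map_eq_zero_of_eq _ (i := Fin.castAdd a j) (j := Fin.natAdd b i) ?_ ?_
      · rw [Fin.append_left, Fin.append_right, hj, hβl, latticeTuple_apply]
      · intro h
        have h' := congrArg Fin.val h
        simp only [Fin.val_castAdd, Fin.val_natAdd] at h'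
        omega
    have hR : polFlat Φ η a (exteriorPower.ιMulti ℤ a u) (fun i ↦ β' (v i)) = 0 :=
      polFlat_ιMulti_apply_eq_zero_of_column Φ η u _ i fun k ↦ by
        rw [hj, hβl]
        exact (mem_orthSubspace_iff Φ η).1 (hw j) _ (hu k)
    rw [hL, ContinuousAlternatingMap.smul_apply, hR, smul_zero]

end Duality

/-! ## §4 Consequences: complex orientations, arbitrary subtorus data, the Poincaré dual `P([Y^⊥]) = η♭([Y])`, integrals -/

section Consequences

variable {ι : Type*} [Fintype ι] [DecidableEq ι] {E : Type*} [NormedAddCommGroup E] [NormedSpace ℂ E]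
  (Φ : (ι → ℝ) ≃L[ℝ] E) {η : E [⋀^Fin 2]→L[ℝ] ℝ} {V W : Submodule ℝ (ι → ℝ)} {a b : ℕ}

omit [Fintype ι] [DecidableEq ι] in
/-- **`η♭` maps integral cycles to integral classes, `η♭(H_a(X, ℤ)) ⊆ Hᵃ(X, ℤ)`**, for `η` integral on the
lattice (the periods `det (η(Φmᵢ, Φnⱼ))` are integers; `H_a(X, ℤ)` is spanned by Pontryagin monomials) — the
lattice map `x ↦ b(x, ·)`, `L → L^*`, of an integral form. [cite: Bertrand1997DualityTori, §1 (a) (p. 200: "`M^*` contains `M` if and only if `b` assumes integral values on `M`") and §3 (a) (p. 211: "the polarization `λ` gives rise to an isogeny `φ` between `A` and its dual abelian variety `A^∨`")] -/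
theorem polFlat_mem_integralForms (hint : ∀ m n : ι → ℤ, ∃ z : ℤ, η ![Φ (intVec m), Φ (intVec n)] = z)
    (σ : ⋀[ℤ]^a (ι → ℤ)) : polFlat Φ η a σ ∈ integralForms Φ a := by
  have h : ∀ τ ∈ Submodule.span ℤ (Set.range (exteriorPower.ιMulti ℤ a (M := ι → ℤ))),
      polFlat Φ η a τ ∈ integralForms Φ a := by
    intro τ hτ
    induction hτ using Submodule.span_induction with
    | mem x hx =>
      obtain ⟨m, rfl⟩ := hx
      rw [mem_integralForms_iff]
      intro n
      choose z hz using fun i j ↦ hint (m i) (n j)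
      refine ⟨(Matrix.of z).det, ?_⟩
      have hM : (Matrix.of fun i j ↦ η ![latticeVec Φ (m i), latticeTuple Φ n j]) =
          (Matrix.of z).map (fun x : ℤ ↦ (x : ℝ)) := by
        ext i j
        rw [Matrix.of_apply, latticeTuple_apply, Matrix.map_apply, Matrix.of_apply, ← hz]
        rfl
      rw [polFlat_ιMulti_apply, hM, ← Int.cast_det, Complex.ofReal_intCast]
    | zero => rw [map_zero]; exact zero_mem _
    | add x y _ _ hx hy => rw [map_add]; exact add_mem hx hy
    | smul c x _ hx => rw [map_zsmul]; exact zsmul_mem hx c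
  exact h σ ((exteriorPower.ιMulti_span ℤ a (ι → ℤ)).ge Submodule.mem_top)

omit [Fintype ι] [DecidableEq ι] in
/-- `η♭([Y]) ∈ Hᵃ(X, ℤ)` for a polarisation `η`. [cite: Bertrand1997DualityTori, §1 (a) (p. 200) and §3 (a) (p. 211)] -/
theorem IsRiemannForm.polFlat_mem_integralForms (hη : IsRiemannForm Φ η) (σ : ⋀[ℤ]^a (ι → ℤ)) :
    polFlat Φ η a σ ∈ integralForms Φ a :=
  ComplexTorus.polFlat_mem_integralForms Φ hη.2.1 σ

/-- **The duality theorem for a pair `(V, W)` with `W = V^⊥`** (the form in which it is applied to both members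
of the complementary pair). [cite: Bertrand1997DualityTori, §1 (b) Prop. 1 (pp. 200–201) and §3 (a) Thm. 3 (p. 212)] -/
theorem IsPrincipalPolarization.cycleFormOfFrame_eq_smul_polFlat_of_orthSubspace_eq (hp : IsPrincipalPolarization Φ η)
    (hWV : orthSubspace Φ η V = W) (hV : IsLatticeSubspace V) (hVc : IsComplexSubspace Φ V) (hW : IsLatticeSubspace W)
    (hWc : IsComplexSubspace Φ W) (e : Fin (b + a) ≃ ι) (eV : Fin a ≃ Fin (subRank V)) (eW : Fin b ≃ Fin (subRank W)) :
    cycleFormOfFrame Φ e (fun j ↦ adaptedBasis W (adaptedEmb W (eW j))) =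
      ((orientationSign (subtorusPeriod Φ W hW hWc) eW * orientationSign (subtorusPeriod Φ V hV hVc) eV : ℤ) : ℂ) •
        polFlat Φ η a (exteriorPower.ιMulti ℤ a fun i ↦ adaptedBasis V (adaptedEmb V (eV i))) := by
  subst hWV
  exact hp.cycleFormOfFrame_orthSubspace_eq_smul_polFlat Φ hV hVc hW hWc e eV eW

/-- **The symmetric statement `cl(Y) = ± η♭([Y^⊥])`** (`(V^⊥)^⊥ = V`: `Y` is the complementary sub-torus of
`Z = Y^⊥`; "`Vol(M) = Vol(M^⊥)`" is symmetric in `M`, `M^⊥`). [cite: Bertrand1997DualityTori, §1 (b) Prop. 1 (pp. 200–201) and §3 (a) Thm. 3 (p. 212)] -/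
theorem IsPrincipalPolarization.cycleFormOfFrame_eq_smul_polFlat_orthSubspace (hp : IsPrincipalPolarization Φ η)
    (hV : IsLatticeSubspace V) (hVc : IsComplexSubspace Φ V) (hW : IsLatticeSubspace (orthSubspace Φ η V))
    (hWc : IsComplexSubspace Φ (orthSubspace Φ η V)) (e' : Fin (a + b) ≃ ι) (eV : Fin a ≃ Fin (subRank V))
    (eW : Fin b ≃ Fin (subRank (orthSubspace Φ η V))) :
    cycleFormOfFrame Φ e' (fun i ↦ adaptedBasis V (adaptedEmb V (eV i))) =
      ((orientationSign (subtorusPeriod Φ V hV hVc) eV *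
          orientationSign (subtorusPeriod Φ (orthSubspace Φ η V) hW hWc) eW : ℤ) : ℂ) •
        polFlat Φ η b (exteriorPower.ιMulti ℤ b fun j ↦ adaptedBasis (orthSubspace Φ η V) (adaptedEmb _ (eW j))) :=
  hp.cycleFormOfFrame_eq_smul_polFlat_of_orthSubspace_eq Φ (orthSubspace_orthSubspace Φ hp.isRiemannForm hVc) hW hWc
    hV hVc e' eW eV

/-- **`η♭([Y]) = ± cl(Y^⊥)`** (the duality theorem solved for `η♭([Y])`; the sign squares to `1`).
[cite: Bertrand1997DualityTori, §1 (b) Prop. 1 (pp. 200–201) and §3 (a) Thm. 3 (p. 212)] -/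
theorem IsPrincipalPolarization.polFlat_eq_smul_cycleFormOfFrame_orthSubspace (hp : IsPrincipalPolarization Φ η)
    (hV : IsLatticeSubspace V) (hVc : IsComplexSubspace Φ V) (hW : IsLatticeSubspace (orthSubspace Φ η V))
    (hWc : IsComplexSubspace Φ (orthSubspace Φ η V)) (e : Fin (b + a) ≃ ι) (eV : Fin a ≃ Fin (subRank V))
    (eW : Fin b ≃ Fin (subRank (orthSubspace Φ η V))) :
    polFlat Φ η a (exteriorPower.ιMulti ℤ a fun i ↦ adaptedBasis V (adaptedEmb V (eV i))) =
      ((orientationSign (subtorusPeriod Φ (orthSubspace Φ η V) hW hWc) eW *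
          orientationSign (subtorusPeriod Φ V hV hVc) eV : ℤ) : ℂ) •
        cycleFormOfFrame Φ e (fun j ↦ adaptedBasis (orthSubspace Φ η V) (adaptedEmb _ (eW j))) := by
  have hs : (orientationSign (subtorusPeriod Φ (orthSubspace Φ η V) hW hWc) eW *
      orientationSign (subtorusPeriod Φ V hV hVc) eV) *
      (orientationSign (subtorusPeriod Φ (orthSubspace Φ η V) hW hWc) eW *
        orientationSign (subtorusPeriod Φ V hV hVc) eV) = 1 := by
    have h1 := orientationSign_mul_self (subtorusPeriod Φ (orthSubspace Φ η V) hW hWc) eW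
    have h2 := orientationSign_mul_self (subtorusPeriod Φ V hV hVc) eV
    linear_combination (orientationSign (subtorusPeriod Φ V hV hVc) eV * orientationSign (subtorusPeriod Φ V hV hVc) eV) * h1 + h2
  rw [hp.cycleFormOfFrame_orthSubspace_eq_smul_polFlat Φ hV hVc hW hWc e eV eW, smul_smul, ← Int.cast_mul, hs,
    Int.cast_one, one_smul]

/-- **`cl(Y^⊥) = η♭([Y])` ON THE NOSE for complex orientations** (positively oriented enumerations `eV`, `eW`,
which exist: tree `exists_orientationSign_subtorusPeriod_eq_one`): the class of the complementary abelian
subvariety IS the polarisation dual of the fundamental class — Bertrand's "dual subtori".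
[cite: Bertrand1997DualityTori, §3 Thm. 3 (p. 212; p. 199: "Over `ℂ`, this boils down to the study of dual subtori in `(ℝ/ℤ)^{2n}`") and §1 (b) Prop. 1 (pp. 200–201)] -/
theorem IsPrincipalPolarization.cycleFormOfFrame_orthSubspace_eq_polFlat (hp : IsPrincipalPolarization Φ η)
    (hV : IsLatticeSubspace V) (hVc : IsComplexSubspace Φ V) (hW : IsLatticeSubspace (orthSubspace Φ η V))
    (hWc : IsComplexSubspace Φ (orthSubspace Φ η V)) (e : Fin (b + a) ≃ ι) {eV : Fin a ≃ Fin (subRank V)}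
    (hposV : orientationSign (subtorusPeriod Φ V hV hVc) eV = 1) {eW : Fin b ≃ Fin (subRank (orthSubspace Φ η V))}
    (hposW : orientationSign (subtorusPeriod Φ (orthSubspace Φ η V) hW hWc) eW = 1) :
    cycleFormOfFrame Φ e (fun j ↦ adaptedBasis (orthSubspace Φ η V) (adaptedEmb _ (eW j))) =
      polFlat Φ η a (exteriorPower.ιMulti ℤ a fun i ↦ adaptedBasis V (adaptedEmb V (eV i))) := by
  rw [hp.cycleFormOfFrame_orthSubspace_eq_smul_polFlat Φ hV hVc hW hWc e eV eW, hposV, hposW, mul_one, Int.cast_one,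
    one_smul]

/-- **`[Z] = η♭([Y])` for the subtorus data of record** (`SubtorusFrame.ofSubspace` of `Z = Y^⊥` and of `Y`,
any positively oriented enumerations): the cycle class `[Z] ∈ Hᵃ(X, ℤ)` of the tree's `SubtorusFrame`
presentation of `Y^⊥` is `η♭` of the Pontryagin monomial of the frame of `Y`.
[cite: Bertrand1997DualityTori, §3 (a) Thm. 3 (p. 212) and §1 (b) Prop. 1 (pp. 200–201)] -/
theorem IsPrincipalPolarization.cycleForm_ofSubspace_orthSubspace_eq_polFlat (hp : IsPrincipalPolarization Φ η)
    (hV : IsLatticeSubspace V) (hVc : IsComplexSubspace Φ V) (hW : IsLatticeSubspace (orthSubspace Φ η V))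
    (hWc : IsComplexSubspace Φ (orthSubspace Φ η V)) (e : Fin (b + a) ≃ ι) {eV : Fin a ≃ Fin (subRank V)}
    (hposV : orientationSign (subtorusPeriod Φ V hV hVc) eV = 1) {eW : Fin b ≃ Fin (subRank (orthSubspace Φ η V))}
    (hposW : orientationSign (subtorusPeriod Φ (orthSubspace Φ η V) hW hWc) eW = 1) :
    (SubtorusFrame.ofSubspace Φ (orthSubspace Φ η V) hW hWc eW hposW).cycleForm e =
      polFlat Φ η a (exteriorPower.ιMulti ℤ a (SubtorusFrame.ofSubspace Φ V hV hVc eV hposV).frame) :=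
  hp.cycleFormOfFrame_orthSubspace_eq_polFlat Φ hV hVc hW hWc e hposV hposW

omit [DecidableEq ι] in
/-- A subtorus datum with real span `ΦV` has `rk(Λ ∩ V)` frame vectors. [cite: Lange2023AbelianVarietiesComplex, §1.1.6 Exercise (2)(a) (p. 26)] -/
private theorem SubtorusFrame.frameCard_eq_subRank_of_realSpan_eq (hV : IsLatticeSubspace V) {M : ℕ} (Y' : SubtorusFrame Φ M)
    (hY' : Y'.realSpan = V.map (Φ : (ι → ℝ) →ₗ[ℝ] E)) : M = subRank V := by
  rw [← finrank_eq_subRank hV, (Submodule.equivMapOfInjective (Φ : (ι → ℝ) →ₗ[ℝ] E) Φ.injective V).finrank_eq,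
    ← hY', SubtorusFrame.realSpan, finrank_span_eq_card Y'.linearIndependent, Fintype.card_fin]

/-- **The fundamental class `[Z] = u₀ ⋆ ⋯ ⋆ u_{m-1} ∈ H_m(X, ℤ)` of a subtorus datum depends only on the
(oriented) complex subtorus**: two data with the same real span have the same Pontryagin monomial (their
Poincaré duals are the cycle classes, which agree — tree `SubtorusFrame.cycleForm_eq_of_realSpan_eq` — and
`P` is injective). [cite: Lange2023AbelianVarietiesComplex, §4.2 (the fundamental class, p. 203) and §2.5.3 Lemma 2.5.14] -/
theorem SubtorusFrame.ιMulti_frame_eq_of_realSpan_eq {m : ℕ} (Z Z' : SubtorusFrame Φ m)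
    (h : Z.realSpan = Z'.realSpan) : exteriorPower.ιMulti ℤ m Z.frame = exteriorPower.ιMulti ℤ m Z'.frame := by
  have hm : m ≤ Fintype.card ι := by
    haveI := finiteDimensional_real Φ (Fintype.equivFin ι).symm
    have h1 := Z.linearIndependent.fintype_card_le_finrank
    rwa [Fintype.card_fin, finrank_real_eq Φ (Fintype.equivFin ι).symm] at h1
  let e : Fin ((Fintype.card ι - m) + m) ≃ ι := (finCongr (Nat.sub_add_cancel hm)).trans (Fintype.equivFin ι).symm
  apply cyclePoincareDual_injective Φ e
  rw [cyclePoincareDual_ιMulti, cyclePoincareDual_ιMulti]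
  exact congrArg _ (SubtorusFrame.cycleForm_eq_of_realSpan_eq Z Z' h _)

/-- **`cl(Z) = η♭([Y])` for ARBITRARY subtorus data presenting `Y` and `Z = Y^⊥`** (any saturated, positively
oriented `ℤ`-bases of `Λ ∩ V` and `Λ ∩ V^⊥` — the tree's `SubtorusFrame`s with the right real spans): no sign,
no enumeration. This is the invariant content of Bertrand's duality "`cl(B^⊥) = η♭([B])`" for a principally
polarised torus. [cite: Bertrand1997DualityTori, §3 (a) Thm. 3 (p. 212) and §1 (b) Prop. 1 (pp. 200–201)] -/
theorem IsPrincipalPolarization.cycleForm_eq_polFlat_of_realSpan_eq (hp : IsPrincipalPolarization Φ η)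
    (hV : IsLatticeSubspace V) (hVc : IsComplexSubspace Φ V) (Y' : SubtorusFrame Φ a)
    (hY' : Y'.realSpan = V.map (Φ : (ι → ℝ) →ₗ[ℝ] E)) (Z' : SubtorusFrame Φ b)
    (hZ' : Z'.realSpan = (orthSubspace Φ η V).map (Φ : (ι → ℝ) →ₗ[ℝ] E)) (e : Fin (b + a) ≃ ι) :
    Z'.cycleForm e = polFlat Φ η a (exteriorPower.ιMulti ℤ a Y'.frame) := by
  have hη := hp.isRiemannForm
  have hW : IsLatticeSubspace (orthSubspace Φ η V) := isLatticeSubspace_orthSubspace Φ hη hV hVc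
  have hWc : IsComplexSubspace Φ (orthSubspace Φ η V) := isComplexSubspace_orthSubspace Φ hη.1 hVc
  obtain rfl := Y'.frameCard_eq_subRank_of_realSpan_eq Φ hV hY'
  obtain rfl := Z'.frameCard_eq_subRank_of_realSpan_eq Φ hW hZ'
  obtain ⟨eV, hposV⟩ := exists_orientationSign_subtorusPeriod_eq_one Φ V hV hVc
  obtain ⟨eW, hposW⟩ := exists_orientationSign_subtorusPeriod_eq_one Φ (orthSubspace Φ η V) hW hWc
  rw [SubtorusFrame.cycleForm_eq_of_realSpan_eq Z' (SubtorusFrame.ofSubspace Φ _ hW hWc eW hposW)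
      (by rw [hZ', SubtorusFrame.realSpan_ofSubspace]) e,
    Y'.ιMulti_frame_eq_of_realSpan_eq Φ (SubtorusFrame.ofSubspace Φ V hV hVc eV hposV)
      (by rw [hY', SubtorusFrame.realSpan_ofSubspace])]
  exact hp.cycleForm_ofSubspace_orthSubspace_eq_polFlat Φ hV hVc hW hWc e hposV hposW

/-- **`P([Z]) = ± η♭([Y])` on `H_b(X, ℤ)`**: the Poincaré dual (tree `cyclePoincareDual`, Lange's `P`) of the
Pontryagin monomial `[Z] = w₀ ⋆ ⋯ ⋆ w_{b-1}` of the adapted basis of `Λ ∩ V^⊥` is `η♭([Y])` up to the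
orientation characters (`b` is even, so Lange's sign `(-1)^{ab}` is `1`). [cite: Bertrand1997DualityTori, §3 (a) Thm. 3 (p. 212)] [cite: Lange2023AbelianVarietiesComplex, §2.5.3 Lemma 2.5.14] -/
theorem IsPrincipalPolarization.cyclePoincareDual_orthSubspace_eq_smul_polFlat (hp : IsPrincipalPolarization Φ η)
    (hV : IsLatticeSubspace V) (hVc : IsComplexSubspace Φ V) (hW : IsLatticeSubspace (orthSubspace Φ η V))
    (hWc : IsComplexSubspace Φ (orthSubspace Φ η V)) (e₂ : Fin (a + b) ≃ ι) (eV : Fin a ≃ Fin (subRank V))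
    (eW : Fin b ≃ Fin (subRank (orthSubspace Φ η V))) :
    cyclePoincareDual Φ e₂ (exteriorPower.ιMulti ℤ b fun j ↦ adaptedBasis (orthSubspace Φ η V) (adaptedEmb _ (eW j))) =
      ((orientationSign (subtorusPeriod Φ (orthSubspace Φ η V) hW hWc) eW *
          orientationSign (subtorusPeriod Φ V hV hVc) eV : ℤ) : ℂ) •
        polFlat Φ η a (exteriorPower.ιMulti ℤ a fun i ↦ adaptedBasis V (adaptedEmb V (eV i))) := by
  rw [cyclePoincareDual_ιMulti, Even.neg_one_pow ((even_of_equiv_subRank Φ _ hW hWc eW).mul_right a), one_smul]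
  exact hp.cycleFormOfFrame_orthSubspace_eq_smul_polFlat Φ hV hVc hW hWc _ eV eW

/-- **`P([Y^⊥]) = ± η♭([Y])` for the fundamental classes of record** (tree `subtorusFundamentalCycle`, the
Pontryagin products of the adapted bases in their given enumerations).
[cite: Bertrand1997DualityTori, §3 (a) Thm. 3 (p. 212)] [cite: Lange2023AbelianVarietiesComplex, §4.2 (p. 203)] -/
theorem IsPrincipalPolarization.cyclePoincareDual_subtorusFundamentalCycle_orthSubspace
    (hp : IsPrincipalPolarization Φ η) (hV : IsLatticeSubspace V) (hVc : IsComplexSubspace Φ V)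
    (hW : IsLatticeSubspace (orthSubspace Φ η V)) (hWc : IsComplexSubspace Φ (orthSubspace Φ η V))
    (e₂ : Fin (subRank V + subRank (orthSubspace Φ η V)) ≃ ι) :
    cyclePoincareDual Φ e₂ (subtorusFundamentalCycle (orthSubspace Φ η V)) =
      ((orientationSign (subtorusPeriod Φ (orthSubspace Φ η V) hW hWc) (Equiv.refl _) *
          orientationSign (subtorusPeriod Φ V hV hVc) (Equiv.refl _) : ℤ) : ℂ) •
        polFlat Φ η (subRank V) (subtorusFundamentalCycle V) := by
  rw [subtorusFundamentalCycle_eq, subtorusFundamentalCycle_eq]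
  exact hp.cyclePoincareDual_orthSubspace_eq_smul_polFlat Φ hV hVc hW hWc e₂ (Equiv.refl _) (Equiv.refl _)

/-- **`∫_X θ ∧ η♭([Y]) = ± ∫_Z θ`** for every invariant `b`-form `θ` (`Z = Y^⊥`; `∫_Z θ = θ(Φw)`): integrating
against `η♭([Y])` is restriction to the complementary sub-torus — the defining property of the Poincaré dual
`cl(Z)`, transported by the duality theorem. [cite: Bertrand1997DualityTori, §3 (a) Thm. 3 (p. 212)] [cite: Lange2023AbelianVarietiesComplex, §2.5.3 Lemma 2.5.14 ("`∫_X P(λ_I) ∧ φ = ∫_{λ_I} φ`")] -/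
theorem IsPrincipalPolarization.torusIntegral_wedge_polFlat (hp : IsPrincipalPolarization Φ η)
    (hV : IsLatticeSubspace V) (hVc : IsComplexSubspace Φ V) (hW : IsLatticeSubspace (orthSubspace Φ η V))
    (hWc : IsComplexSubspace Φ (orthSubspace Φ η V)) (e : Fin (b + a) ≃ ι) (eV : Fin a ≃ Fin (subRank V))
    (eW : Fin b ≃ Fin (subRank (orthSubspace Φ η V))) (θ : E [⋀^Fin b]→L[ℝ] ℂ) :
    torusIntegral Φ e (θ.wedge (polFlat Φ η a (exteriorPower.ιMulti ℤ a fun i ↦ adaptedBasis V (adaptedEmb V (eV i))))) =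
      ((orientationSign (subtorusPeriod Φ (orthSubspace Φ η V) hW hWc) eW *
          orientationSign (subtorusPeriod Φ V hV hVc) eV : ℤ) : ℂ) *
        θ (latticeTuple Φ fun j ↦ adaptedBasis (orthSubspace Φ η V) (adaptedEmb _ (eW j))) := by
  rw [hp.polFlat_eq_smul_cycleFormOfFrame_orthSubspace Φ hV hVc hW hWc e eV eW, wedge_smul_right_complex,
    torusIntegral_smul, torusIntegral_wedge_cycleFormOfFrame]

/-- **`∫_X θ ∧ η♭([Y]) = ∫_{[Z]} θ`** with complex orientations, `[Z] = w₀ ⋆ ⋯ ⋆ w_{b-1}` (tree `cycleIntegral`).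
[cite: Bertrand1997DualityTori, §3 (a) Thm. 3 (p. 212)] [cite: Lange2023AbelianVarietiesComplex, §2.5.3 Lemma 2.5.12 / 2.5.14] -/
theorem IsPrincipalPolarization.torusIntegral_wedge_polFlat_eq_cycleIntegral (hp : IsPrincipalPolarization Φ η)
    (hV : IsLatticeSubspace V) (hVc : IsComplexSubspace Φ V) (hW : IsLatticeSubspace (orthSubspace Φ η V))
    (hWc : IsComplexSubspace Φ (orthSubspace Φ η V)) (e : Fin (b + a) ≃ ι) {eV : Fin a ≃ Fin (subRank V)}
    (hposV : orientationSign (subtorusPeriod Φ V hV hVc) eV = 1) {eW : Fin b ≃ Fin (subRank (orthSubspace Φ η V))}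
    (hposW : orientationSign (subtorusPeriod Φ (orthSubspace Φ η V) hW hWc) eW = 1) (θ : E [⋀^Fin b]→L[ℝ] ℂ) :
    torusIntegral Φ e (θ.wedge (polFlat Φ η a (exteriorPower.ιMulti ℤ a fun i ↦ adaptedBasis V (adaptedEmb V (eV i))))) =
      cycleIntegral Φ b (exteriorPower.ιMulti ℤ b fun j ↦ adaptedBasis (orthSubspace Φ η V) (adaptedEmb _ (eW j))) θ := by
  rw [hp.torusIntegral_wedge_polFlat Φ hV hVc hW hWc e eV eW, hposV, hposW, mul_one, Int.cast_one, one_mul,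
    cycleIntegral_ιMulti]

end Consequences

end ComplexTorus

end Literature.Geometry.Kaehler
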